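import Literature.AlgebraicGeometry.AbelianSchemes.PolarizedAbelianSchemeLocalEmbedding
import Literature.AlgebraicGeometry.Morphisms.ProjectiveOverBaseOfFibres
import Literature.AlgebraicGeometry.Modules.SerreTwistOneOfFrameSections
import HarnessLib

/-!
# The chart embeddings of «REL-EMB-SPREAD» in the Hom-scheme currency: `X ×_T Spec R ↪ 𝐏(ι; Spec R)` over `Spec R` for EVERY finite
# index type `ι` with `#ι ≥ m` (padding by zero sections), with `𝒪(1)|` the given line bundle

Topic `AlgebraicGeometry/ProjectiveGeometry`; namespaces `Literature.AlgebraicGeometry.Morphisms` (§1–§2, generic) and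
`Literature.AlgebraicGeometry.AbelianSchemes.AbelianSchemeOver` (§3).  THEOREMS ONLY (no definition, no named fact, no instance, no notation, no
`sorry`); universe `Scheme.{0}`.  Cell `hodgecm-mathlib` (D-0151), P6 «MOD programme», organ «REL-EMB-SPREAD» FILE 3 (A-p14 (g34) 23:05:29Z «YES
PLEASE — the line՚s binder I-EMB is in the Hom-scheme currency `Morphisms.projectiveSpace (Fin n) U`»; B-p10 (g29)): the binders `(jᵢ, hjᵢc, hjᵢ, eᵢ)`
of `Cruxes/HLiu418/Lines/F0_P6a_IsomSchemeFiniteType.lean` §1∕§2 read `jᵢ : 𝒜ᵢ|_U ⟶ 𝐏(ι; U)` a CLOSED immersion OVER `U` with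
`twistMod (jᵢ ≫ pr₂) 𝒪 1 ≅ L^Δ(λᵢ)^{⊗3}|`, BOTH tuples in ONE `𝐏(ι; U)`; ★ REL-EMB FILES 1–2 deliver `toProj` over an affine chart with SOME
`m + 1` sections.  This file converts: PADDING by zero sections (a sub-family embeds ⇒ the family embeds, ★ `isClosedImmersion_toProj_of_restrict`,
Hartshorne II Prop. 7.2) makes the number of sections ANY `#ι + 1 ≥ m + 1`; the `T`-point of `𝐏(ι; Spec R)` of the padded datum (★
`projectiveSpace.pointOfSections`) is a closed immersion because every fibre is (★ `isClosedImmersion_pointOfSections_of_isPullback`, EGA III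
4.6.7 (ii), fibres by UP ★ `isClosedImmersion_toProj_comap`), and its `𝒪(1)` is the module of the sections (★ V2
`nonempty_iso_twistMod_one_homEquiv_pointOfSections_ofFrameSystem`, Hartshorne II Thm. 7.1 (a)).  Count-neutral: HC_CM is proved only modulo
the printed citations until rung 0 closes.

* §1 `exists_isClosedImmersion_projectiveSpace_of_toProj` — the padding∕conversion at one chart (generic: `f′ : X′ → Spec R` proper, a rank-one
  framed `E′`, `m + 1` sections embedding ⇒ for every finite `ι` with `m ≤ #ι` a closed `Spec R`-immersion `j : X′ ↪ 𝐏(ι; Spec R)` with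
  `twistMod (j ≫ pr₂) 𝒪 1 ≅ E′`).
* §2 **`exists_affineOpen_isClosedImmersion_projectiveSpace`** — ★ REL-EMB FILE 1 `exists_affineOpen_isClosedImmersion_toProj` in this letter.
* §3 **`exists_affineOpen_isClosedImmersion_projectiveSpace_LDelta_three_of_polarization`** — ★ REL-EMB FILE 2 §2(c) in this letter: for a
  polarised `𝒜/T` and `x` of characteristic `0`, an affine open `ι_R : Spec R ↪ T` through `x` and, for every cartesian square `A′ = A ×_T Spec R`,
  an `m` such that for EVERY finite `ι` with `m ≤ #ι` there is a closed `Spec R`-immersion `j : A′ ↪ 𝐏(ι; Spec R)` with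
  `twistMod (j ≫ pr₂) 𝒪_{A′} 1 ≅ (L^Δ(λ)^{⊗3})|_{A′}` — the (I-EMB) binders, one common `ι` for finitely many charts and both tuples by taking
  `#ι ≥` every `m` (and `≥ 1`).

## References
* [Hartshorne1977] R. Hartshorne, *Algebraic Geometry* (1977), II Thm. 7.1 (p. 150), II Prop. 7.2 (p. 151), II §4 Definition p. 103.
* [EGAIII1] A. Grothendieck, J. Dieudonné, *EGA III₁* (1961), Prop. (4.6.7) (ii), Thm. (4.7.1) (p. 145).
* [MumfordFogartyKirwan1994] D. Mumford, J. Fogarty, F. Kirwan, *Geometric Invariant Theory*, 3rd ed. (1994), Ch. 0 §5 (c) (p. 23), Ch. 7 §2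
  Prop. 7.6 (p. 136).
* [StacksProject] The Stacks Project, Tag 01NF.
-/

noncomputable section

-- `TopCat.Presheaf`/`Scheme.Modules` and pull-back bookkeeping (as in ★ `ProjectiveGeometry/RelativeEmbeddingNearFibre`).
set_option backward.isDefEq.respectTransparency false

open CategoryTheory CategoryTheory.Limits CategoryTheory.Abelian AlgebraicGeometry TopologicalSpace Opposite
open Literature.AlgebraicGeometry.Modules Literature.AlgebraicGeometry.Modules.SerreTwist
open Literature.AlgebraicGeometry.Motives Literature.AlgebraicGeometry.Motives.GeneratingSections

namespace Literature.AlgebraicGeometry.Morphisms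

/-! ## §1 Padding by zero sections and the `𝐏(ι; Spec R)` reading at one chart -/

section Padding

variable {R : Type} [CommRing R] {X' : Scheme.{0}} (f' : X' ⟶ Spec (.of R)) [IsProper f']
  {E' : X'.Modules} (F' : FrameSystem E') (h1' : ∀ z, F'.rank z = 1) {m : ℕ} (b : Fin (m + 1) → Γ(E', ⊤))
  (hcov : ⨆ i, ⨆ z, X'.basicOpen ((CocycleSections.ofFrameSystem F' h1' b).coeff i z) = ⊤)
  (H : IsClosedImmersion ((ofCocycleSections F'.U (CocycleSections.ofFrameSystem F' h1' b) hcov).toProj f'))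

include hcov H in
/-- **PADDING + THE `𝐏(ι; Spec R)` READING.**  `f′ : X′ → Spec R` proper, `E′` with a rank-one frame system `F′`, `m + 1` sections `b` generating
`E′` whose morphism `X′ → ℙ^m_R` is a closed immersion.  THEN for every finite index type `ι` with `m ≤ #ι` there is a CLOSED IMMERSION
`j : X′ ⟶ 𝐏(ι; Spec R)` OVER `Spec R` (`j ≫ pr₁ = f′`) with `twistMod (j ≫ pr₂) 𝒪_{X′} 1 ≅ E′`: pad `b` by zero sections to `#ι + 1` sections
(the sub-family `b` embeds ⇒ the padded family embeds, ★ `isClosedImmersion_toProj_of_restrict`), take the `Spec R`-point of `𝐏(ι; Spec R)` it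
defines (★ `projectiveSpace.pointOfSections`; a closed immersion since every fibre is, ★ `isClosedImmersion_pointOfSections_of_isPullback` with
UP ★ `isClosedImmersion_toProj_comap`), and read `𝒪(1)` by ★ V2 `nonempty_iso_twistMod_one_homEquiv_pointOfSections_ofFrameSystem`.
[cite: Hartshorne1977, II Thm. 7.1 (p. 150) and II Prop. 7.2 (p. 151)] [cite: EGAIII1, Prop. (4.6.7) (ii)] -/
theorem exists_isClosedImmersion_projectiveSpace_of_toProj (ι : Type) [Finite ι] (hι : m ≤ Nat.card ι) :
    ∃ j : X' ⟶ Morphisms.projectiveSpace ι (Spec (.of R)), IsClosedImmersion j ∧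
      j ≫ Morphisms.projectiveSpaceFst ι (Spec (.of R)) = f' ∧
      Nonempty (twistMod (j ≫ pullback.snd (terminal.from (Spec (.of R))) (terminal.from (Morphisms.projectiveSpaceInt ι)))
        (unitModule X') 1 ≅ E') := by
  classical
  -- the padded family `b′ : Fin (#ι + 1) → Γ(E′)`, `b′ ∘ e = b` for `e := Fin.castLE`
  let e : Fin (m + 1) → Fin (Nat.card ι + 1) := Fin.castLE (by omega)
  let b' : Fin (Nat.card ι + 1) → Γ(E', ⊤) := fun j ↦ if h : (j : ℕ) < m + 1 then b ⟨j, h⟩ else 0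
  have hb' : (fun i ↦ b' (e i)) = b := by
    funext i
    change (if h : ((Fin.castLE _ i : Fin (Nat.card ι + 1)) : ℕ) < m + 1 then b ⟨_, h⟩ else 0) = b i
    rw [dif_pos (by simp [i.2])]
    rfl
  have hres : (CocycleSections.ofFrameSystem F' h1' b').restrict e = CocycleSections.ofFrameSystem F' h1' b := by
    refine CocycleSections.ext (funext fun i ↦ funext fun z ↦ ?_)
    rw [CocycleSections.restrict_coeff, CocycleSections.ofFrameSystem_coeff, CocycleSections.ofFrameSystem_coeff, ← hb']
    rfl
  have hcovr : ⨆ i, ⨆ z, X'.basicOpen (((CocycleSections.ofFrameSystem F' h1' b').restrict e).coeff i z) = ⊤ := by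
    rw [hres]; exact hcov
  have hcov' : ⨆ i, ⨆ z, X'.basicOpen ((CocycleSections.ofFrameSystem F' h1' b').coeff i z) = ⊤ :=
    CocycleSections.iSup_basicOpen_coeff_eq_top_of_restrict _ e hcovr
  let D' : GeneratingSections (Fin (Nat.card ι + 1)) X' := ofCocycleSections F'.U (CocycleSections.ofFrameSystem F' h1' b') hcov'
  -- the padded family embeds
  have hD'res : ofCocycleSections F'.U (CocycleSections.ofFrameSystem F' h1' b) hcov = D'.restrict e hcovr := by
    have := CocycleSections.ofCocycleSections_restrict (CocycleSections.ofFrameSystem F' h1' b') e hcovr hcov'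
    rw [← this]
    congr 1
    exact hres.symm
  haveI : UniversallyClosed f' := inferInstance
  have H' : IsClosedImmersion (D'.toProj f') := by
    refine isClosedImmersion_toProj_of_restrict (f := f') (D := D') (e := e) (hcov := hcovr) ?_
    rw [← hD'res]; exact H
  -- the `Spec R`-point of `𝐏(ι; Spec R)`; a closed immersion fibre by fibre
  let j : X' ⟶ Morphisms.projectiveSpace ι (Spec (.of R)) := (projectiveSpace.pointOfSections (Over.mk f') D').left
  have hjfst : j ≫ Morphisms.projectiveSpaceFst ι (Spec (.of R)) = f' := Over.w (projectiveSpace.pointOfSections (Over.mk f') D')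
  have hjc : IsClosedImmersion j := by
    refine isClosedImmersion_pointOfSections_of_isPullback f' ι D' fun 𝔭 ↦ ?_
    letI : Algebra R 𝔭.asIdeal.ResidueField := inferInstance
    let iK : Spec (.of 𝔭.asIdeal.ResidueField) ⟶ Spec (.of R) := Spec.map (CommRingCat.ofHom (algebraMap R 𝔭.asIdeal.ResidueField))
    haveI := H'
    exact ⟨𝔭.asIdeal.ResidueField, inferInstance, iK, Spec.map (Scheme.Spec.residueFieldIso (.of R) 𝔭).inv,
      Scheme.Spec.map_residueFieldIso_inv_eq_fromSpecResidueField (.of R) 𝔭, pullback f' iK, pullback.fst f' iK, pullback.snd f' iK,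
      IsPullback.of_hasPullback f' iK,
      GeneratingSections.isClosedImmersion_toProj_comap D' f' (pullback.snd f' iK) (pullback.fst f' iK) (IsPullback.of_hasPullback f' iK)⟩
  -- `𝒪(1)` of the point is `E′`
  obtain ⟨ψ⟩ := nonempty_iso_twistMod_one_homEquiv_pointOfSections_ofFrameSystem (J := ι) f' F' h1' b' hcov'
  refine ⟨j, hjc, hjfst, ⟨?_⟩⟩
  rw [projectiveSpace.homEquiv_apply] at ψ
  exact ψ.symm

end Padding

/-! ## §2 REL-EMB FILE 1 in the `𝐏(ι; Spec R)` letter -/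

section Chart

variable {T X : Scheme.{0}} [IsLocallyNoetherian T] (f : X ⟶ T) [IsProper f] [Flat f]
  {E : X.Modules} (F : FrameSystem E) (h1 : ∀ x, F.rank x = 1) (x : T)
  {K : Type} [Field K] (xK : Spec (.of K) ⟶ T) (hx : x ∈ Set.range xK)
  {X₁ : Scheme.{0}} {i₁ : X₁ ⟶ X} {f₁ : X₁ ⟶ Spec (.of K)} (H₁ : IsPullback i₁ f₁ f xK)
  (hvan : Subsingleton (Ext.{1} (unitModule X₁) ((Scheme.Modules.pullback i₁).obj E) 1))
  (h1₁ : ∀ x, (F.pullback i₁).rank x = 1) {n : ℕ} (s : Fin (n + 1) → Γ((Scheme.Modules.pullback i₁).obj E, ⊤))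
  (hcov : ⨆ i, ⨆ x, X₁.basicOpen ((CocycleSections.ofFrameSystem (F.pullback i₁) h1₁ s).coeff i x) = ⊤)
  (H : IsClosedImmersion ((ofCocycleSections (F.pullback i₁).U
    (CocycleSections.ofFrameSystem (F.pullback i₁) h1₁ s) hcov).toProj f₁))

include h1 hx H₁ hvan H in
/-- **A RELATIVE EMBEDDING SPREADS OFF ONE FIBRE — Hom-scheme letter.**  Under the hypotheses of ★ `exists_affineOpen_isClosedImmersion_toProj`
(one fibre embedded by its own sections of the framed rank-one `E`, `Ext¹ = 0` there; `f` proper flat, `T` locally Noetherian): a Noetherian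
`R`, an affine open immersion `ι_R : Spec R ↪ T` through `x`, and for every cartesian square `X′ = X ×_T Spec R` an `m` such that for EVERY finite
`ι` with `m ≤ #ι` some CLOSED `Spec R`-immersion `j : X′ ↪ 𝐏(ι; Spec R)` has `twistMod (j ≫ pr₂) 𝒪_{X′} 1 ≅ E|_{X′}` (§1 over ★ REL-EMB FILE 1).
[cite: EGAIII1, Thm. (4.7.1) p. 145] [cite: Hartshorne1977, II Thm. 7.1 (p. 150)] -/
theorem exists_affineOpen_isClosedImmersion_projectiveSpace :
    ∃ (R : Type) (_ : CommRing R) (_ : IsNoetherianRing R) (ιR : Spec (.of R) ⟶ T) (_ : IsOpenImmersion ιR), x ∈ Set.range ιR ∧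
      ∀ {X' : Scheme.{0}} (i' : X' ⟶ X) (f' : X' ⟶ Spec (.of R)), IsPullback i' f' f ιR →
        ∃ m : ℕ, ∀ (ι : Type) [Finite ι], m ≤ Nat.card ι →
          ∃ j : X' ⟶ Morphisms.projectiveSpace ι (Spec (.of R)), IsClosedImmersion j ∧
            j ≫ Morphisms.projectiveSpaceFst ι (Spec (.of R)) = f' ∧
            Nonempty (twistMod (j ≫ pullback.snd (terminal.from (Spec (.of R))) (terminal.from (Morphisms.projectiveSpaceInt ι)))
              (unitModule X') 1 ≅ (Scheme.Modules.pullback i').obj E) := by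
  obtain ⟨R, _, _, ιR, _, hxR, hemb⟩ := exists_affineOpen_isClosedImmersion_toProj f F h1 x xK hx H₁ hvan h1₁ s hcov H
  refine ⟨R, inferInstance, inferInstance, ιR, inferInstance, hxR, fun i' f' Hi' ↦ ?_⟩
  obtain ⟨m, b, hcov', H'⟩ := hemb i' f' Hi'
  haveI : IsProper f' := MorphismProperty.of_isPullback Hi' inferInstance
  exact ⟨m, fun ι _ hι ↦ exists_isClosedImmersion_projectiveSpace_of_toProj f' (F.pullback i') _ b hcov' H' ι hι⟩

end Chart

end Literature.AlgebraicGeometry.Morphisms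

/-! ## §3 The polarised abelian scheme, Hom-scheme letter (the (I-EMB) binders) -/

namespace Literature.AlgebraicGeometry.AbelianSchemes

namespace AbelianSchemeOver

open Literature.AlgebraicGeometry.Morphisms Literature.AlgebraicGeometry.Modules Literature.AlgebraicGeometry.Motives
open Literature.AlgebraicGeometry.Modules.SerreTwist

/-- **(I-EMB) FOR A POLARISED ABELIAN SCHEME AT A CHARACTERISTIC-`0` POINT.**  `T` locally Noetherian, `𝒜/T` an abelian scheme with a
polarisation `pol` (graph `Gr` of `pol.lam`), `x ∈ T` with `CharZero κ(x)`.  THEN there are a Noetherian `R`, an affine open immersion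
`ι_R : Spec R ↪ T` through `x`, and for every cartesian square `A′ = A ×_T Spec R` (`i′`, `f′`) an `m` such that for EVERY finite index type `ι`
with `m ≤ #ι` there is a CLOSED `Spec R`-IMMERSION `j : A′ ↪ 𝐏(ι; Spec R)` (`j ≫ pr₁ = f′`) with
`twistMod (j ≫ pr₂) 𝒪_{A′} 1 ≅ (L^Δ(λ)^{⊗3})|_{A′}` — the binders `(jᵢ, hjᵢc, hjᵢ, eᵢ)` of `Lines/F0_P6a_IsomSchemeFiniteType` over the chart,
with ONE `ι` serving finitely many charts and both tuples (take `#ι ≥` every `m`, and `≥ 1`).  ★ REL-EMB FILE 2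
`…_LDelta_three_of_polarization` + §1. [cite: MumfordFogartyKirwan1994, Ch. 7 §2 Prop. 7.6 (p. 136) and Ch. 0 §5 (c) (p. 23)]
[cite: EGAIII1, Thm. (4.7.1) p. 145] [cite: Hartshorne1977, II Thm. 7.1 (p. 150)] -/
theorem exists_affineOpen_isClosedImmersion_projectiveSpace_LDelta_three_of_polarization {T : Scheme.{0}} [IsLocallyNoetherian T]
    (𝒜 : AbelianSchemeOver T) (D : 𝒜.DualPair) (pol : 𝒜.Polarization D)
    (Gr : 𝒜.X.left ⟶ 𝒜.prodLeft D.hat) (hGr₁ : Gr ≫ pullback.fst 𝒜.X.hom D.hat.X.hom = 𝟙 _)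
    (hGr₂ : Gr ≫ pullback.snd 𝒜.X.hom D.hat.X.hom = pol.lam.left)
    (F : FrameSystem (tensorPow ((Scheme.Modules.pullback Gr).obj D.P) 3)) (h1 : ∀ x, F.rank x = 1) (x : T)
    [CharZero (T.residueField x)] :
    ∃ (R : Type) (_ : CommRing R) (_ : IsNoetherianRing R) (ιR : Spec (.of R) ⟶ T) (_ : IsOpenImmersion ιR), x ∈ Set.range ιR ∧
      ∀ {X' : Scheme.{0}} (i' : X' ⟶ 𝒜.X.left) (f' : X' ⟶ Spec (.of R)), IsPullback i' f' 𝒜.X.hom ιR →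
        ∃ m : ℕ, ∀ (ι : Type) [Finite ι], m ≤ Nat.card ι →
          ∃ j : X' ⟶ Morphisms.projectiveSpace ι (Spec (.of R)), IsClosedImmersion j ∧
            j ≫ Morphisms.projectiveSpaceFst ι (Spec (.of R)) = f' ∧
            Nonempty (twistMod (j ≫ pullback.snd (terminal.from (Spec (.of R))) (terminal.from (Morphisms.projectiveSpaceInt ι)))
              (unitModule X') 1 ≅ (Scheme.Modules.pullback i').obj (tensorPow ((Scheme.Modules.pullback Gr).obj D.P) 3)) := by
  haveI : IsProper 𝒜.X.hom := 𝒜.isProper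
  obtain ⟨R, _, _, ιR, _, hxR, hemb⟩ :=
    𝒜.exists_affineOpen_isClosedImmersion_toProj_LDelta_three_of_polarization D pol Gr hGr₁ hGr₂ F h1 x
  refine ⟨R, inferInstance, inferInstance, ιR, inferInstance, hxR, fun i' f' Hi' ↦ ?_⟩
  obtain ⟨m, b, hcov', H'⟩ := hemb i' f' Hi'
  haveI : IsProper f' := MorphismProperty.of_isPullback Hi' inferInstance
  exact ⟨m, fun ι _ hι ↦ exists_isClosedImmersion_projectiveSpace_of_toProj f' (F.pullback i') _ b hcov' H' ι hι⟩

end AbelianSchemeOver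

end Literature.AlgebraicGeometry.AbelianSchemes

end
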